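import Summits.HubbardSuperconductivity.HubbardSuperconductivity.Theorems.ThermalWedgeTwApproximatingHamiltonian
import Summits.HubbardSuperconductivity.HubbardSuperconductivity.Theorems.TwSeededEnsembleEquivalence.Negative.BetaMonotonicity
import Literature.MathematicalPhysics.QuantumLattice.DWaveSourceProofs

/-!
# Crux `TwSeededEnsembleEquivalence` (stmt-HubbardSuperconductivity-1698), line `exposed-density-duality` — stub `stub_t0AHM`

THE `T = 0` APPROXIMATING-HAMILTONIAN BOUND FOR THE `d`-WAVE-SEEDED HUBBARD TORUS, both halves,
uniformly in the chemical potential on compacts `|μ| ≤ M`. Notation: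
`Hgc_L(μ) = hubbardTorusWith 2 L 1 U μ − (g/L²) Δ_dᴴ Δ_d` (`Δ_d = pairField dWaveFormFactor L`),
`S_L(μ,h) = dWaveSourceTorus L U μ h = hubbardTorusWith 2 L 1 U μ − h (Δ_d + Δ_dᴴ)`.

* easy half (`t0AHM_groundEnergy_le`, every `L, μ, h`): `E₀(Hgc_L(μ)) ≤ E₀(S_L(μ,h)) + h²L²/g`.
  The completed square of the tree's `log_partitionFn_approx_le_model` at the real amplitude
  `c = h/√g` gives `log Z_β(S_L(μ,h)) − βL²h²/g ≤ log Z_β(Hgc_L(μ))` for every `β ≥ 0`; the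
  entropy sandwich `−βE₀ ≤ log Z_β ≤ L² log 4 − βE₀` (`Negative/BetaMonotonicity`) and `β → ∞`
  finish.
* hard half (`t0AHM_pressure_bound` + `stub_t0AHM`): `∀ ε ∃ L₀ ∀ L ≥ L₀ ∀ |μ| ≤ M ∃ h ≥ 0`,
  `E₀(S_L(μ,h)) + h²L²/g ≤ E₀(Hgc_L(μ)) + εL²`. The finite-volume Bogoliubov Jr. estimate
  `exists_pressure_model_le` is instantiated EXACTLY as in the thermal item
  `twApproximatingHamiltonian_proof` (W = √g Δ_d, V = L², trivial double-commutator bounds,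
  locality constants of `ThermalWedgeTwApproximatingHamiltonianLocality`, gauge rotation
  `twAhm_partitionFn_approx_eq_dWaveSourceTorus` making the amplitude real), with the single change
  that the commutator constant `‖[T_μ, Δ_d]‖ ≤ 45·2(2 + |U| + 2|μ|)·pd·L²` is made `μ`-uniform by
  `|μ| ≤ M ≤ |M|`; then at FIXED `L` the inverse temperature `β := max 1 (2 log 4/ε)` and the same
  sandwich turn the pressure bound into the ground-energy bound (no compactness is needed).

Sources: Bogolyubov Jr.–Brankov–Zagrebnov–Kurbatov–Tonchev (1984); Bru–de Siqueira Pedra,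
Mem. AMS 224 (2013), Appendix, Theorem 107. No definitions are introduced.
-/

-- the tree's layout `Summit.HubbardSuperconductivity.HubbardSuperconductivity.…` repeats a namespace component
set_option linter.dupNamespace false

noncomputable section

namespace Summit.HubbardSuperconductivity.HubbardSuperconductivity.Theorems.TwSeededEnsembleEquivalence.ExposedDensity

open Matrix Filter Topology Literature.MathematicalPhysics.QuantumLattice
open Literature.Probability.LatticeModels
open Summit.HubbardSuperconductivity.HubbardSuperconductivity.Theorems.TwSeededEnsembleEquivalence.Negative
open scoped ComplexOrder Matrix.Norms.L2Operator

/-- **Entropy sandwich, comparison form.** For Hermitian `A, B` and `β ≥ 0`, a comparison of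
log-partition functions `log Z_β(A) + a ≤ log Z_β(B) + b` yields the ground-energy comparison
`β E₀(B) + a ≤ β E₀(A) + b + log dim` (`−βE₀(A) ≤ log Z_β(A)` and `log Z_β(B) ≤ log dim − βE₀(B)`).
[folklore] -/
theorem t0AHM_groundEnergy_sandwich {m : Type*} [Fintype m] [DecidableEq m] [Nonempty m]
    {A B : Matrix m m ℂ} (hA : A.IsHermitian) (hB : B.IsHermitian) {β a b : ℝ} (hβ : 0 ≤ β)
    (h : Real.log (A.partitionFn β).re + a ≤ Real.log (B.partitionFn β).re + b) :
    β * B.groundEnergy + a ≤ β * A.groundEnergy + b + Real.log (Fintype.card m) := by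
  have hlow := neg_mul_groundEnergy_le_log_partitionFn hA β
  have hup := log_partitionFn_le_log_card_sub hB hβ
  linarith

/-- **Easy half of the `T = 0` approximating-Hamiltonian bound** (every `L`, `μ`, real `h`):
`E₀(Hgc_L(μ)) ≤ E₀(dWaveSourceTorus L U μ h) + h²L²/g`, from the completed square
`−(g/L²)ΔᴴΔ ≤ −h(Δ + Δᴴ) + (h²L²/g)·1` in its thermal form `log_partitionFn_approx_le_model`
(amplitude `c = h/√g`), the entropy sandwich and `β → ∞`.
Bru–de Siqueira Pedra (2013), Theorem 107 (lower bound). -/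
theorem t0AHM_groundEnergy_le (L : ℕ) [NeZero L] (U μ h : ℝ) {g : ℝ} (hg : 0 < g) :
    (hubbardTorusWith 2 L 1 U μ - ((g / (L : ℝ) ^ 2 : ℝ) : ℂ) •
        ((pairField dWaveFormFactor L)ᴴ * pairField dWaveFormFactor L)).groundEnergy ≤
      (dWaveSourceTorus L U μ h).groundEnergy + h ^ 2 * (L : ℝ) ^ 2 / g := by
  have hT : (hubbardTorusWith 2 L 1 U μ).IsHermitian := isHermitian_hubbardTorusWith L 1 U μ
  have hS : (dWaveSourceTorus L U μ h).IsHermitian := dWaveSourceTorus_isHermitian L hT h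
  have hH := isHermitian_seededGC L U μ g
  have hV : (0 : ℝ) < (L : ℝ) ^ 2 := cast_sq_pos_of_neZero L
  have hlog4 : 0 < Real.log 4 := Real.log_pos (by norm_num)
  refine le_of_forall_pos_le_add fun κ hκ => ?_
  -- inverse temperature with entropy allowance `L² log 4 = κ (β - 1) < κ β`
  obtain ⟨β, hβdef⟩ : ∃ β : ℝ, β = (L : ℝ) ^ 2 * Real.log 4 / κ + 1 := ⟨_, rfl⟩
  have hβ : 0 < β := by rw [hβdef]; positivity
  have hK : (L : ℝ) ^ 2 * Real.log 4 = κ * (β - 1) := by rw [hβdef]; field_simp; ring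
  have key := log_partitionFn_approx_le_model hT
    (((Real.sqrt g : ℝ) : ℂ) • pairField dWaveFormFactor L) hβ.le hV ((h / Real.sqrt g : ℝ) : ℂ)
  rw [twAhm_approx_real_eq L U μ h hg, twAhm_model_eq L U μ hg.le, Complex.norm_real,
    Real.norm_eq_abs, sq_abs, div_pow, Real.sq_sqrt hg.le] at key
  have hsw := t0AHM_groundEnergy_sandwich hS hH hβ.le (a := -(β * (L : ℝ) ^ 2 * (h ^ 2 / g)))
    (b := 0) (by linarith only [key])
  rw [log_card_fock] at hsw
  refine le_of_mul_le_mul_left ?_ hβ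
  have hβκ : 0 ≤ β * κ := by positivity
  have e1 : β * ((dWaveSourceTorus L U μ h).groundEnergy + h ^ 2 * (L : ℝ) ^ 2 / g + κ) =
      β * (dWaveSourceTorus L U μ h).groundEnergy + β * (L : ℝ) ^ 2 * (h ^ 2 / g) + κ * β := by
    ring
  rw [e1]
  linarith

/-- **Hard half, thermal form, uniformly in `|μ| ≤ M`** (the finite-volume Bogoliubov Jr. estimate):
for `g, ε, β > 0` there is `L₀` such that for all `L ≥ L₀` and `|μ| ≤ M` some REAL source `h ≥ 0`
has `p_L(β,μ,g) ≤ p̃_L(β,μ,h) − h²/g + ε` (`p = log Re Z/(βL²)`). This is the hard half of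
`twApproximatingHamiltonian_proof` verbatim (`exists_pressure_model_le` at `W = √g Δ_d`, `V = L²`,
trivial double-commutator bounds, gauge rotation `h = |c|√g`), except that the commutator
constant `‖[T_μ, Δ_d]‖ ≤ 45·2(2 + |U| + 2|μ|)·pd·L²` is bounded using `|μ| ≤ |M|`, which makes
`L₀` independent of `μ`. Bogolyubov Jr. et al. (1984); Bru–de Siqueira Pedra (2013) Thm 107 (ii). -/
theorem t0AHM_pressure_bound (U g M ε β : ℝ) (hg : 0 < g) (hε : 0 < ε) (hβ : 0 < β) :
    ∃ L₀ : ℕ, ∀ (L : ℕ) [NeZero L], L₀ ≤ L → ∀ μ : ℝ, |μ| ≤ M → ∃ h : ℝ, 0 ≤ h ∧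
      Real.log (partitionFn β (hubbardTorusWith 2 L 1 U μ - ((g / (L : ℝ) ^ 2 : ℝ) : ℂ) •
          ((pairField dWaveFormFactor L)ᴴ * pairField dWaveFormFactor L))).re /
          (β * (L : ℝ) ^ 2) ≤
        Real.log (partitionFn β (dWaveSourceTorus L U μ h)).re / (β * (L : ℝ) ^ 2) -
          h ^ 2 / g + ε := by
  have hT : ∀ (L : ℕ) (μ : ℝ), (hubbardTorusWith 2 L 1 U μ).IsHermitian := fun L μ =>
    isHermitian_hubbardTorusWith L 1 U μ
  have hsg : 0 < Real.sqrt g := Real.sqrt_pos.2 hg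
  -- `L`- and `μ`-independent constants (kept opaque: `positivity` must not unfold the Finset sums)
  obtain ⟨pd, hpd⟩ : ∃ pd : ℝ,
      pd = 2 * ∑ e ∈ insert (0 : Site 2) unitSteps, |dWaveFormFactor e / Real.sqrt 2| := ⟨_, rfl⟩
  have hpd0 : 0 ≤ pd := by rw [hpd]; positivity
  obtain ⟨a, ha⟩ : ∃ a : ℝ, a = Real.sqrt g := ⟨_, rfl⟩
  have ha0 : 0 < a := by rw [ha]; exact hsg
  obtain ⟨C₁, hC₁⟩ : ∃ C₁ : ℝ, C₁ = a * pd := ⟨_, rfl⟩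
  have hC₁0 : 0 ≤ C₁ := by rw [hC₁]; positivity
  obtain ⟨C₂, hC₂⟩ : ∃ C₂ : ℝ, C₂ = g * (25 * (2 * pd ^ 2)) := ⟨_, rfl⟩
  have hC₂0 : 0 ≤ C₂ := by rw [hC₂]; positivity
  obtain ⟨κ₀, hκ₀⟩ : ∃ κ₀ : ℝ, κ₀ = 45 * (2 * (2 * |(1 : ℝ)| + |U| + 2 * |M|) * pd) := ⟨_, rfl⟩
  have hκ₀0 : 0 ≤ κ₀ := by rw [hκ₀]; positivity
  obtain ⟨c₃, hc₃⟩ : ∃ c₃ : ℝ, c₃ = 2 * C₁ * C₂ := ⟨_, rfl⟩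
  obtain ⟨c₄, hc₄⟩ : ∃ c₄ : ℝ, c₄ = 2 * C₁ * (a * κ₀) := ⟨_, rfl⟩
  have hc₃0 : 0 ≤ c₃ := by rw [hc₃]; positivity
  have hc₄0 : 0 ≤ c₄ := by rw [hc₄]; positivity
  obtain ⟨r, hr⟩ : ∃ r : ℝ, r = ε / (8 * (C₁ + 1)) := ⟨_, rfl⟩
  have hr0 : 0 < r := by rw [hr]; positivity
  obtain ⟨A₁, hA₁⟩ : ∃ A₁ : ℝ, A₁ = C₁ * (c₄ + c₃ * C₁) / r := ⟨_, rfl⟩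
  obtain ⟨B₁, hB₁⟩ : ∃ B₁ : ℝ, B₁ = C₁ * (2 * (C₂ / 2) ^ 2) / r := ⟨_, rfl⟩
  obtain ⟨A₂, hA₂⟩ : ∃ A₂ : ℝ, A₂ = C₁ * (c₄ + C₁ * c₃) / r := ⟨_, rfl⟩
  have hA₁0 : 0 ≤ A₁ := by rw [hA₁]; positivity
  have hB₁0 : 0 ≤ B₁ := by rw [hB₁]; positivity
  have hA₂0 : 0 ≤ A₂ := by rw [hA₂]; positivity
  obtain ⟨K, hK⟩ : ∃ K : ℝ,
      K = C₂ / 2 + 2 * C₁ / (β * r) + (Real.sqrt (A₁ + B₁) + Real.sqrt (A₂ + 0)) / 2 :=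
    ⟨_, rfl⟩
  have hK0 : 0 ≤ K := by rw [hK]; positivity
  refine ⟨⌈2 * K / ε⌉₊ + 1, ?_⟩
  intro L _ hL μ hμ
  have hLpos : (0 : ℝ) < (L : ℝ) := by exact_mod_cast NeZero.pos L
  have hL1 : (1 : ℝ) ≤ (L : ℝ) := by exact_mod_cast NeZero.pos L
  have hV : (0 : ℝ) < (L : ℝ) ^ 2 := by positivity
  have hV1 : (1 : ℝ) ≤ (L : ℝ) ^ 2 := by nlinarith
  have hLK : 2 * K / ε ≤ (L : ℝ) := by
    have h1 : (2 * K / ε : ℝ) ≤ (⌈2 * K / ε⌉₊ : ℝ) := Nat.le_ceil _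
    have h2 : ((⌈2 * K / ε⌉₊ + 1 : ℕ) : ℝ) ≤ (L : ℝ) := by exact_mod_cast hL
    push_cast at h2
    linarith
  have hμM : |μ| ≤ |M| := hμ.trans (le_abs_self M)
  -- the channel `W = a·Δ_d` and its bounds in the box of side `L`
  have hΔn : ‖pairField dWaveFormFactor L‖ ≤ pd * (L : ℝ) ^ 2 := by
    rw [hpd]; exact norm_pairField_le dWaveFormFactor L
  have hWn : ‖(((a : ℝ) : ℂ) • pairField dWaveFormFactor L)‖ =
      a * ‖pairField dWaveFormFactor L‖ := by rw [twAhm_norm_real_smul, abs_of_pos ha0]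
  have hU : ‖(((a : ℝ) : ℂ) • pairField dWaveFormFactor L)‖ ≤ C₁ * (L : ℝ) ^ 2 := by
    rw [hWn, hC₁, mul_assoc]
    exact mul_le_mul_of_nonneg_left hΔn ha0.le
  have hWH : ‖((((a : ℝ) : ℂ) • pairField dWaveFormFactor L))ᴴ‖ =
      ‖(((a : ℝ) : ℂ) • pairField dWaveFormFactor L)‖ := l2_opNorm_conjTranspose _
  have hWreal : ((((a : ℝ) : ℂ) • pairField dWaveFormFactor L))ᴴ =
      ((a : ℝ) : ℂ) • (pairField dWaveFormFactor L)ᴴ := by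
    rw [conjTranspose_smul, Complex.star_def, Complex.conj_ofReal]
  have hcommW : (((a : ℝ) : ℂ) • pairField dWaveFormFactor L) *
        ((((a : ℝ) : ℂ) • pairField dWaveFormFactor L))ᴴ -
      ((((a : ℝ) : ℂ) • pairField dWaveFormFactor L))ᴴ *
        (((a : ℝ) : ℂ) • pairField dWaveFormFactor L) =
      ((a * a : ℝ) : ℂ) • (pairField dWaveFormFactor L * (pairField dWaveFormFactor L)ᴴ -
        (pairField dWaveFormFactor L)ᴴ * pairField dWaveFormFactor L) := by
    rw [hWreal, smul_mul_smul_comm, smul_mul_smul_comm, ← smul_sub, Complex.ofReal_mul]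
  have h2 : ‖(((a : ℝ) : ℂ) • pairField dWaveFormFactor L) *
        ((((a : ℝ) : ℂ) • pairField dWaveFormFactor L))ᴴ -
      ((((a : ℝ) : ℂ) • pairField dWaveFormFactor L))ᴴ *
        (((a : ℝ) : ℂ) • pairField dWaveFormFactor L)‖ ≤ (L : ℝ) ^ 2 * C₂ := by
    rw [hcommW, twAhm_norm_real_smul, abs_of_pos (mul_pos ha0 ha0),
      show a * a = g by rw [ha]; exact Real.mul_self_sqrt hg.le, hC₂]
    have := twAhm_norm_comm_pairField_conjTranspose_le L dWaveFormFactor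
    rw [← hpd] at this
    calc g * ‖pairField dWaveFormFactor L * (pairField dWaveFormFactor L)ᴴ -
          (pairField dWaveFormFactor L)ᴴ * pairField dWaveFormFactor L‖
        ≤ g * (25 * (2 * pd ^ 2) * (L : ℝ) ^ 2) := mul_le_mul_of_nonneg_left this hg.le
      _ = (L : ℝ) ^ 2 * (g * (25 * (2 * pd ^ 2))) := by ring
  have h2' : ‖⁅((((a : ℝ) : ℂ) • pairField dWaveFormFactor L))ᴴ,
      (((a : ℝ) : ℂ) • pairField dWaveFormFactor L)⁆‖ ≤ (L : ℝ) ^ 2 * C₂ := by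
    rw [Ring.lie_def, norm_sub_rev]; exact h2
  have h3a : ‖⁅(((a : ℝ) : ℂ) • pairField dWaveFormFactor L),
      ⁅((((a : ℝ) : ℂ) • pairField dWaveFormFactor L))ᴴ,
        (((a : ℝ) : ℂ) • pairField dWaveFormFactor L)⁆⁆‖ ≤
      (L : ℝ) ^ 2 * (c₃ * (L : ℝ) ^ 2) := by
    refine (twAhm_norm_lie_le _ _).trans ?_
    calc 2 * ‖(((a : ℝ) : ℂ) • pairField dWaveFormFactor L)‖ *
          ‖⁅((((a : ℝ) : ℂ) • pairField dWaveFormFactor L))ᴴ,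
            (((a : ℝ) : ℂ) • pairField dWaveFormFactor L)⁆‖
        ≤ 2 * (C₁ * (L : ℝ) ^ 2) * ((L : ℝ) ^ 2 * C₂) :=
          mul_le_mul (mul_le_mul_of_nonneg_left hU (by norm_num)) h2' (norm_nonneg _)
            (by positivity)
      _ = (L : ℝ) ^ 2 * (c₃ * (L : ℝ) ^ 2) := by rw [hc₃]; ring
  have h3b : ‖⁅((((a : ℝ) : ℂ) • pairField dWaveFormFactor L))ᴴ,
      ⁅((((a : ℝ) : ℂ) • pairField dWaveFormFactor L))ᴴ,
        (((a : ℝ) : ℂ) • pairField dWaveFormFactor L)⁆⁆‖ ≤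
      (L : ℝ) ^ 2 * (c₃ * (L : ℝ) ^ 2) := by
    refine (twAhm_norm_lie_le _ _).trans ?_
    rw [hWH]
    calc 2 * ‖(((a : ℝ) : ℂ) • pairField dWaveFormFactor L)‖ *
          ‖⁅((((a : ℝ) : ℂ) • pairField dWaveFormFactor L))ᴴ,
            (((a : ℝ) : ℂ) • pairField dWaveFormFactor L)⁆‖
        ≤ 2 * (C₁ * (L : ℝ) ^ 2) * ((L : ℝ) ^ 2 * C₂) :=
          mul_le_mul (mul_le_mul_of_nonneg_left hU (by norm_num)) h2' (norm_nonneg _)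
            (by positivity)
      _ = (L : ℝ) ^ 2 * (c₃ * (L : ℝ) ^ 2) := by rw [hc₃]; ring
  have hWK : ‖⁅(((a : ℝ) : ℂ) • pairField dWaveFormFactor L), hubbardTorusWith 2 L 1 U μ⁆‖ ≤
      a * κ₀ * (L : ℝ) ^ 2 := by
    have hlie : ⁅(((a : ℝ) : ℂ) • pairField dWaveFormFactor L), hubbardTorusWith 2 L 1 U μ⁆ =
        ((a : ℝ) : ℂ) • (pairField dWaveFormFactor L * hubbardTorusWith 2 L 1 U μ -
          hubbardTorusWith 2 L 1 U μ * pairField dWaveFormFactor L) := by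
      rw [Ring.lie_def, Matrix.smul_mul, Matrix.mul_smul, smul_sub]
    rw [hlie, twAhm_norm_real_smul, abs_of_pos ha0, norm_sub_rev, mul_assoc]
    refine mul_le_mul_of_nonneg_left ?_ ha0.le
    have := twAhm_norm_comm_hubbardTorusWith_pairField_le L 1 U μ dWaveFormFactor
    rw [← hpd] at this
    refine this.trans ?_
    rw [hκ₀]
    have hpdV : 0 ≤ pd * (L : ℝ) ^ 2 := by positivity
    have hfact := mul_le_mul_of_nonneg_right hμM hpdV
    linarith only [hfact]
  have h4a : ‖⁅(((a : ℝ) : ℂ) • pairField dWaveFormFactor L),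
      ⁅(((a : ℝ) : ℂ) • pairField dWaveFormFactor L), hubbardTorusWith 2 L 1 U μ⁆⁆‖ ≤
      (L : ℝ) ^ 2 * (c₄ * (L : ℝ) ^ 2) := by
    refine (twAhm_norm_lie_le _ _).trans ?_
    calc 2 * ‖(((a : ℝ) : ℂ) • pairField dWaveFormFactor L)‖ *
          ‖⁅(((a : ℝ) : ℂ) • pairField dWaveFormFactor L), hubbardTorusWith 2 L 1 U μ⁆‖
        ≤ 2 * (C₁ * (L : ℝ) ^ 2) * (a * κ₀ * (L : ℝ) ^ 2) :=
          mul_le_mul (mul_le_mul_of_nonneg_left hU (by norm_num)) hWK (norm_nonneg _)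
            (by positivity)
      _ = (L : ℝ) ^ 2 * (c₄ * (L : ℝ) ^ 2) := by rw [hc₄]; ring
  have h4b : ‖⁅((((a : ℝ) : ℂ) • pairField dWaveFormFactor L))ᴴ,
      ⁅(((a : ℝ) : ℂ) • pairField dWaveFormFactor L), hubbardTorusWith 2 L 1 U μ⁆⁆‖ ≤
      (L : ℝ) ^ 2 * (c₄ * (L : ℝ) ^ 2) := by
    refine (twAhm_norm_lie_le _ _).trans ?_
    rw [hWH]
    calc 2 * ‖(((a : ℝ) : ℂ) • pairField dWaveFormFactor L)‖ *
          ‖⁅(((a : ℝ) : ℂ) • pairField dWaveFormFactor L), hubbardTorusWith 2 L 1 U μ⁆‖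
        ≤ 2 * (C₁ * (L : ℝ) ^ 2) * (a * κ₀ * (L : ℝ) ^ 2) :=
          mul_le_mul (mul_le_mul_of_nonneg_left hU (by norm_num)) hWK (norm_nonneg _)
            (by positivity)
      _ = (L : ℝ) ^ 2 * (c₄ * (L : ℝ) ^ 2) := by rw [hc₄]; ring
  -- Bogoliubov Jr.'s estimate in the box of side `L`
  obtain ⟨c, hc⟩ := exists_pressure_model_le (hT L μ)
    ((((a : ℝ) : ℂ) • pairField dWaveFormFactor L)) hβ hV hr0 hU h2 h3a h3b h4a h4b
  clear hU h2 h2' h3a h3b h4a h4b hWK hcommW hWreal hWH hWn hΔn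
  -- the error is at most `ε`
  have h4r : 4 * r * C₁ ≤ ε / 2 := by
    rw [hr, show 4 * (ε / (8 * (C₁ + 1))) * C₁ = ε / 2 * (C₁ / (C₁ + 1)) by field_simp; ring]
    have hC1 : 0 < C₁ + 1 := by linarith
    have h1 : C₁ / (C₁ + 1) ≤ 1 := (div_le_one hC1).2 (by linarith)
    have hε2 : 0 ≤ ε / 2 := by linarith
    calc ε / 2 * (C₁ / (C₁ + 1)) ≤ ε / 2 * 1 := mul_le_mul_of_nonneg_left h1 hε2
      _ = ε / 2 := mul_one _
  have hrad1 : C₁ * (c₄ * (L : ℝ) ^ 2 + 2 * (c₃ * (L : ℝ) ^ 2 / 2) * C₁ + 2 * (C₂ / 2) ^ 2) / r =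
      A₁ * (L : ℝ) ^ 2 + B₁ := by
    rw [hA₁, hB₁]; field_simp
  have hrad2 : C₁ * (c₄ * (L : ℝ) ^ 2 + 2 * C₁ * (c₃ * (L : ℝ) ^ 2 / 2)) / r =
      A₂ * (L : ℝ) ^ 2 + 0 := by
    rw [hA₂]; field_simp; ring
  have hsqL : Real.sqrt ((L : ℝ) ^ 2) = (L : ℝ) := Real.sqrt_sq hLpos.le
  have hs1 : Real.sqrt (C₁ * (c₄ * (L : ℝ) ^ 2 + 2 * (c₃ * (L : ℝ) ^ 2 / 2) * C₁ +
      2 * (C₂ / 2) ^ 2) / r) ≤ Real.sqrt (A₁ + B₁) * (L : ℝ) := by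
    rw [hrad1]
    calc Real.sqrt (A₁ * (L : ℝ) ^ 2 + B₁) ≤ Real.sqrt (A₁ + B₁) * Real.sqrt ((L : ℝ) ^ 2) :=
          twAhm_sqrt_affine_le hA₁0 hB₁0 hV1
      _ = Real.sqrt (A₁ + B₁) * (L : ℝ) := by rw [hsqL]
  have hs2 : Real.sqrt (C₁ * (c₄ * (L : ℝ) ^ 2 + 2 * C₁ * (c₃ * (L : ℝ) ^ 2 / 2)) / r) ≤
      Real.sqrt (A₂ + 0) * (L : ℝ) := by
    rw [hrad2]
    calc Real.sqrt (A₂ * (L : ℝ) ^ 2 + 0) ≤ Real.sqrt (A₂ + 0) * Real.sqrt ((L : ℝ) ^ 2) :=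
          twAhm_sqrt_affine_le hA₂0 le_rfl hV1
      _ = Real.sqrt (A₂ + 0) * (L : ℝ) := by rw [hsqL]
  have hQ : (C₂ / 2 + 2 * C₁ / (β * r) +
      (Real.sqrt (C₁ * (c₄ * (L : ℝ) ^ 2 + 2 * (c₃ * (L : ℝ) ^ 2 / 2) * C₁ +
          2 * (C₂ / 2) ^ 2) / r) +
        Real.sqrt (C₁ * (c₄ * (L : ℝ) ^ 2 + 2 * C₁ * (c₃ * (L : ℝ) ^ 2 / 2)) / r)) / 2) /
      (L : ℝ) ^ 2 ≤ ε / 2 := by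
    have hA0 : 0 ≤ C₂ / 2 + 2 * C₁ / (β * r) := by positivity
    have e1 : C₂ / 2 + 2 * C₁ / (β * r) ≤ (C₂ / 2 + 2 * C₁ / (β * r)) * (L : ℝ) :=
      le_mul_of_one_le_right hA0 hL1
    have hnum : C₂ / 2 + 2 * C₁ / (β * r) +
        (Real.sqrt (C₁ * (c₄ * (L : ℝ) ^ 2 + 2 * (c₃ * (L : ℝ) ^ 2 / 2) * C₁ +
            2 * (C₂ / 2) ^ 2) / r) +
          Real.sqrt (C₁ * (c₄ * (L : ℝ) ^ 2 + 2 * C₁ * (c₃ * (L : ℝ) ^ 2 / 2)) / r)) / 2 ≤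
        K * (L : ℝ) := by
      rw [hK]
      linarith
    have hKL : K * (L : ℝ) / (L : ℝ) ^ 2 = K / (L : ℝ) := by
      rw [pow_two, mul_div_mul_right _ _ hLpos.ne']
    have hKε : K / (L : ℝ) ≤ ε / 2 := by
      rw [div_le_iff₀ hLpos]
      have h1 := mul_le_mul_of_nonneg_left hLK (by positivity : (0 : ℝ) ≤ ε / 2)
      have h2 : ε / 2 * (2 * K / ε) = K := by field_simp
      linarith
    calc _ ≤ K * (L : ℝ) / (L : ℝ) ^ 2 := div_le_div_of_nonneg_right hnum hV.le
      _ = K / (L : ℝ) := hKL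
      _ ≤ ε / 2 := hKε
  -- make the amplitude real and conclude
  refine ⟨‖c‖ * Real.sqrt g, by positivity, ?_⟩
  rw [ha] at hc
  rw [twAhm_model_eq L U μ hg.le,
    twAhm_partitionFn_approx_eq_dWaveSourceTorus L β U μ (Real.sqrt g) c] at hc
  have hnorm : ‖c‖ ^ 2 = (‖c‖ * Real.sqrt g) ^ 2 / g := by
    rw [mul_pow, Real.sq_sqrt hg.le, mul_div_assoc, div_self hg.ne', mul_one]
  rw [hnorm] at hc
  have hadd := add_le_add h4r hQ
  rw [add_halves] at hadd
  linarith only [hc, hadd]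

/-- **`stub_t0AHM`** — the `T = 0` approximating-Hamiltonian bound for the `d`-wave-seeded Hubbard
torus, both halves, uniformly in `|μ| ≤ M`: (easy) `E₀(Hgc_L(μ)) ≤ E₀(dWaveSourceTorus L U μ h) +
h²L²/g` for all `L, μ, h` (`t0AHM_groundEnergy_le`); (hard) `∀ ε ∃ L₀ ∀ L ≥ L₀ ∀ |μ| ≤ M ∃ h ≥ 0`,
`E₀(dWaveSourceTorus L U μ h) + h²L²/g ≤ E₀(Hgc_L(μ)) + εL²`, from the `μ`-uniform thermal bound
`t0AHM_pressure_bound` at accuracy `ε/2` and the FIXED inverse temperature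
`β = max 1 (2 log 4/ε)` in the entropy sandwich `−βE₀ ≤ log Z_β ≤ L² log 4 − βE₀` (at fixed `L`;
no compactness). Bogolyubov Jr.–Brankov–Zagrebnov–Kurbatov–Tonchev (1984); Bru–de Siqueira Pedra
(2013), Theorem 107. -/
theorem stub_t0AHM :
    ∀ (U g M : ℝ), 0 < g →
      (∀ (L : ℕ) [NeZero L] (μ h : ℝ),
        (hubbardTorusWith 2 L 1 U μ - ((g / (L : ℝ) ^ 2 : ℝ) : ℂ) •
            ((pairField dWaveFormFactor L)ᴴ * pairField dWaveFormFactor L)).groundEnergy ≤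
          (dWaveSourceTorus L U μ h).groundEnergy + h ^ 2 * (L : ℝ) ^ 2 / g) ∧
      (∀ ε : ℝ, 0 < ε → ∃ L₀ : ℕ, ∀ (L : ℕ) [NeZero L], L₀ ≤ L → ∀ μ : ℝ, |μ| ≤ M →
        ∃ h : ℝ, 0 ≤ h ∧
          (dWaveSourceTorus L U μ h).groundEnergy + h ^ 2 * (L : ℝ) ^ 2 / g ≤
            (hubbardTorusWith 2 L 1 U μ - ((g / (L : ℝ) ^ 2 : ℝ) : ℂ) •
              ((pairField dWaveFormFactor L)ᴴ * pairField dWaveFormFactor L)).groundEnergy +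
              ε * (L : ℝ) ^ 2) := by
  intro U g M hg
  refine ⟨fun L _ μ h => t0AHM_groundEnergy_le L U μ h hg, fun ε hε => ?_⟩
  have hlog4 : 0 < Real.log 4 := Real.log_pos (by norm_num)
  -- a FIXED large inverse temperature: entropy allowance `log 4/β ≤ ε/2`
  obtain ⟨β, hβdef⟩ : ∃ β : ℝ, β = max 1 (2 * Real.log 4 / ε) := ⟨_, rfl⟩
  have hβ1 : 1 ≤ β := hβdef ▸ le_max_left _ _
  have hβ : 0 < β := lt_of_lt_of_le one_pos hβ1
  have hβ2 : 2 * Real.log 4 / ε ≤ β := hβdef ▸ le_max_right _ _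
  have hslack : Real.log 4 ≤ β * (ε / 2) := by
    have h1 : 2 * Real.log 4 / ε * (ε / 2) = Real.log 4 := by field_simp
    have h2 := mul_le_mul_of_nonneg_right hβ2 (by positivity : (0 : ℝ) ≤ ε / 2)
    linarith
  obtain ⟨L₀, hL₀⟩ := t0AHM_pressure_bound U g M (ε / 2) β hg (half_pos hε) hβ
  refine ⟨L₀, fun L _ hL μ hμ => ?_⟩
  obtain ⟨h, hh0, hc⟩ := hL₀ L hL μ hμ
  refine ⟨h, hh0, ?_⟩
  have hV : (0 : ℝ) < (L : ℝ) ^ 2 := cast_sq_pos_of_neZero L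
  have hL0 : (L : ℝ) ≠ 0 := fun h0 => by rw [h0] at hV; simp at hV
  have hβV : 0 < β * (L : ℝ) ^ 2 := mul_pos hβ hV
  have hH := isHermitian_seededGC L U μ g
  have hS : (dWaveSourceTorus L U μ h).IsHermitian :=
    dWaveSourceTorus_isHermitian L (isHermitian_hubbardTorusWith L 1 U μ) h
  -- multiply the pressure bound out
  rw [div_le_iff₀ hβV] at hc
  have e1 : (Real.log (partitionFn β (dWaveSourceTorus L U μ h)).re / (β * (L : ℝ) ^ 2) -
        h ^ 2 / g + ε / 2) * (β * (L : ℝ) ^ 2) =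
      Real.log (partitionFn β (dWaveSourceTorus L U μ h)).re +
        (β * (L : ℝ) ^ 2 * (ε / 2) - β * (h ^ 2 * (L : ℝ) ^ 2 / g)) := by
    field_simp
    ring
  rw [e1] at hc
  have hsw := t0AHM_groundEnergy_sandwich hH hS hβ.le (a := 0)
    (b := β * (L : ℝ) ^ 2 * (ε / 2) - β * (h ^ 2 * (L : ℝ) ^ 2 / g)) (by linarith only [hc])
  rw [log_card_fock] at hsw
  have hVs := mul_le_mul_of_nonneg_left hslack hV.le
  refine le_of_mul_le_mul_left ?_ hβ
  have e2 : β * ((hubbardTorusWith 2 L 1 U μ - ((g / (L : ℝ) ^ 2 : ℝ) : ℂ) •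
        ((pairField dWaveFormFactor L)ᴴ * pairField dWaveFormFactor L)).groundEnergy +
        ε * (L : ℝ) ^ 2) =
      β * (hubbardTorusWith 2 L 1 U μ - ((g / (L : ℝ) ^ 2 : ℝ) : ℂ) •
        ((pairField dWaveFormFactor L)ᴴ * pairField dWaveFormFactor L)).groundEnergy +
        β * (L : ℝ) ^ 2 * (ε / 2) + (L : ℝ) ^ 2 * (β * (ε / 2)) := by
    ring
  rw [mul_add, e2]
  linarith
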